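import Summits.QuantumAdvantage.AdviceFreeQNC0.WindowLadderBlocks
import HarnessLib

/-!
# Cell qa-qnc0 (rung F-Q1, route RingFrame, crux α `RingToElim`): ring strategies supported on the
# ends and ANY FIXED NUMBER of interior windows are hard — the `t`-window ring theorem

The general member of the window ladder on crux α (`RingHardU` in walk coordinates), after
`EndSupportedStrategies.lean` (`t = 0`), `OneWindowStrategies.lean` (`t = 1`) and
`TwoWindowStrategies.lean` (`t = 2`).  Let `l = [L₀, …, L_t]` be `t + 1` large, polynomially
balanced blocks (`log₂ n ≤ 2 log₂ L_i`, `n = Σ l`), anchors `P_j = L₀ + ⋯ + L_{j−1}`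
(`P_0 = 0`), `K ≤ (log₂ n)^C`, and let the walk strategy `y` (selectors of degree `≤ (log₂ n)^C`)
select only positions in the windows `[P_j, P_j + K)` (`j = 0, …, t`; the window at `P_0 = 0` is
the left end) and in the right end `{g : g + K > n}`.  Then for every charge the ring game is
won on at most `(1 − η_{t+1})·2ⁿ` inputs, `η_{t+1} > 0` the constant of `multiElimHard (t+1)`
(`ringWinU_windows_le`).

Proof (prover's normal form, cell memo PROVER-MEMO-gen2 §1–§3).  With the block weights
`R_0, …, R_t` of `u`, the character of position `g` is, modulo `3`, LOCAL DATA `A_g(u)` (a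
function of `< K` coordinates: `c + g + #{P_J ≤ i < g : u_i}` for a position anchored at the last
anchor `P_J ≤ g`, `c + g + 2#{i ≥ g : u_i}` at the right end) plus the linear form
`Σ_i λ_{g,i} R_i` with `λ_{g,i} = 2` for `i < J`, `1` for `i ≥ J` (right end: all `2`).  The last
coefficient `λ_{g,t}` is never `0`, so among the three cells `(0, …, 0, w)`, `w ∈ ℤ/3`, the
hypothetical counts `N(u; 0,…,0,w) = #{g selected : A_g + λ_{g,t} w ≢ 0}` sum to an even number
and one of them, `w₀(u)`, is even (`decoder_even`); `w₀(u)` is read off two parity bits of degree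
`≤ (log₂ n)^C + K` each.  Feed `multiElimHard (t+1)` the constant decoder `0` on the blocks
`0, …, t−1` and the two-bit decoder `w₀` on block `t`: on `≥ η_{t+1}·2ⁿ` inputs ALL residues are
named, i.e. `R_i ≡ 0 (i < t)` and `R_t ≡ w₀(u)`; there the true count `N(u; R(u))` equals
`N(u; 0,…,0,w₀(u))` (counts see residues mod `3` only), which is even — a loss.  No `3^{t+1}`-cell
decoder is needed: the parity obstruction is used in the last residue only, the joint
elimination engine supplies the conditioning on the other residues.

* `ringWinU_windows_le`: the statement above, for every `t`.

The cell's statement (prover; a special case of crux α of route RingFrame); not in print.  With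
it the window ladder is complete at every FIXED number of interior clusters of `(log₂ n)^C`
consecutive walk characters: such strategies do not beat two-bit elimination by more than the
constant `η_{t+1}`; the constants decrease with `t` (iterates of Srinivasan's `η(γ)`), so
nothing uniform in `t` follows.  WHAT THIS IS NOT: unbalanced blocks, windows of
super-polylogarithmic width, dense supports / a number of clusters growing with `n` (the
compounding question = α) are untouched; nothing on `LDMAPolylog`, `TRPlus` or α in general;
no separation.

## References

* S. Srinivasan, *A robust version of Hegedűs's lemma, with applications*, TheoretiCS 2 (2023),
  Lemma 3.1 [Srinivasan2023] (through `multiElimHard`).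
-/

noncomputable section

namespace Summit.QuantumAdvantage.AdviceFreeQNC0

open Finset
open Literature.Computability.MetaComplexity Literature.Computability.MetaComplexity.Smolensky

/-- **Ring strategies supported on the ends and `t` interior windows win on at most
`(1 − η_{t+1})·2ⁿ` inputs.**  For every `t` there is `θ < 1` such that for every `C` and all
lists `l` of `t + 1` large, polynomially balanced block lengths (`log₂ (Σ l) ≤ 2 log₂ L` for
`L ∈ l`): if `K ≤ (log₂ n)^C` (`n = Σ l`) and the walk strategy `y` (selectors of degree
`≤ (log₂ n)^C`) vanishes at every position `g` with `g + K ≤ n` outside the windows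
`[P_j, P_j + K)`, `P_j = (l.take j).sum`, `j ≤ t`, then for every charge `c` the ring game in
walk coordinates is won on at most `θ·2ⁿ` inputs.  A special case of crux α (`RingHardU`) of
route RingFrame.  (Cell statement; parity obstruction in the last block residue, two-bit
decoder of degree `≤ 2((log₂ n)^C + K)`, constant decoders elsewhere, `multiElimHard (t+1)`.)
[cite: Srinivasan2023, Lemma 3.1] -/
theorem ringWinU_windows_le :
    ∀ t : ℕ, ∃ θ : ℝ, θ < 1 ∧ ∀ C : ℕ, ∃ M₀ : ℕ, ∀ l : List ℕ, l.length = t + 1 →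
      (∀ L ∈ l, M₀ ≤ L) → (∀ L ∈ l, Nat.log 2 l.sum ≤ 2 * Nat.log 2 L) →
      ∀ K : ℕ, K ≤ (Nat.log 2 l.sum) ^ C → ∀ c : ℕ,
      ∀ y : Fin (l.sum + 1) → (Fin l.sum → Bool) → Bool,
        (∀ g, HasDeg (y g) ((Nat.log 2 l.sum) ^ C)) →
        (∀ g : Fin (l.sum + 1),
            (∀ j < l.length, g.val < (l.take j).sum ∨ (l.take j).sum + K ≤ g.val) →
            g.val + K ≤ l.sum → ∀ u, y g u = false) →
          ((univ.filter fun u : Fin l.sum → Bool => ringWinU c y u = true).card : ℝ) ≤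
            θ * (2 : ℝ) ^ l.sum := by
  intro t
  classical
  obtain ⟨η, hη, cE, hcE, M, hE⟩ := multiElimHard (t + 1)
  refine ⟨1 - η, by linarith, fun C => ?_⟩
  obtain ⟨n₃, hn₃⟩ := logPow_le_sqrt' (2 * C + 2) hcE
  refine ⟨max (max M n₃) 2048, fun l hl hM hbal K hK c y hdeg hsupp => ?_⟩
  have hMl : ∀ L ∈ l, M ≤ L := fun L hL =>
    le_trans (le_trans (le_max_left _ _) (le_max_left _ _)) (hM L hL)
  have hn₃l : ∀ L ∈ l, n₃ ≤ L := fun L hL =>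
    le_trans (le_trans (le_max_right _ _) (le_max_left _ _)) (hM L hL)
  have h2048 : ∀ L ∈ l, 2048 ≤ L := fun L hL => le_trans (le_max_right _ _) (hM L hL)
  set D := (Nat.log 2 l.sum) ^ C with hD
  -- degree budget: the decoder bits have degree `2(D + K) ≤ 108·D ≤ (log₂ L)^(2C+2) ≤ cE·√L`
  have hdl : ∀ L ∈ l, ((D + K + (D + K) : ℕ) : ℝ) ≤ cE * Real.sqrt L := by
    intro L hL
    have hm11 : 11 ≤ Nat.log 2 L := by
      have h1 : Nat.log 2 2048 ≤ Nat.log 2 L := Nat.log_mono_right (h2048 L hL)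
      have h11 : Nat.log 2 2048 = 11 := by
        rw [show (2048 : ℕ) = 2 ^ 11 by norm_num, Nat.log_pow (by norm_num)]
      omega
    have hbud := degree_budget108 C hm11 (hbal L hL)
    have hKD : K ≤ D := hK
    have h1 : D + K + (D + K) ≤ (Nat.log 2 L) ^ (2 * C + 2) := by omega
    have h2 : ((D + K + (D + K) : ℕ) : ℝ) ≤ (((Nat.log 2 L) ^ (2 * C + 2) : ℕ) : ℝ) := by
      exact_mod_cast h1
    exact h2.trans (hn₃ L (hn₃l L hL))
  -- anchors `P j = (l.take j).sum` and the anchor index `J g` = the last `j ≤ t` with `P j ≤ g`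
  obtain ⟨P, hP⟩ : ∃ P : ℕ → ℕ, ∀ j, P j = (l.take j).sum := ⟨_, fun _ => rfl⟩
  have hP0 : P 0 = 0 := by rw [hP]; simp
  have hPmono : ∀ {j k : ℕ}, j ≤ k → P j ≤ P k := by
    intro j k h; rw [hP, hP]; exact sum_take_mono l h
  obtain ⟨J, hJ⟩ : ∃ J : ℕ → ℕ, ∀ g, J g = Nat.findGreatest (fun j => P j ≤ g) t :=
    ⟨_, fun _ => rfl⟩
  have hJle : ∀ g, J g ≤ t := fun g => by rw [hJ]; exact Nat.findGreatest_le t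
  have hPJ : ∀ g, P (J g) ≤ g := fun g => by
    rw [hJ]
    exact Nat.findGreatest_spec (P := fun j => P j ≤ g) (Nat.zero_le t) (by rw [hP0]; exact Nat.zero_le g)
  have hJmax : ∀ g j, j ≤ t → P j ≤ g → j ≤ J g := fun g j hj hPj => by
    rw [hJ]; exact Nat.le_findGreatest (P := fun j => P j ≤ g) hj hPj
  -- block weights `R u i = |u_{B_i}|`
  obtain ⟨R, hR⟩ : ∃ R : (Fin l.sum → Bool) → ℕ → ℕ, ∀ u i, R u i = (blockWts l u).getD i 0 :=
    ⟨_, fun _ _ => rfl⟩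
  have hwt : ∀ u, wt u = ∑ i ∈ range (t + 1), R u i := by
    intro u
    rw [← hl, wt_eq_sum_blockWts l u]
    exact Finset.sum_congr rfl fun i _ => (hR u i).symm
  have hpre : ∀ u j, j ≤ t + 1 → wtPrefix u (P j) = ∑ i ∈ range j, R u i := by
    intro u j hj
    rw [hP, wtPrefix_sum_take l j (by omega) u]
    exact Finset.sum_congr rfl fun i _ => (hR u i).symm
  -- local data `A` and coefficients `lam` of the characters (right end first, else anchored)
  let A : (Fin l.sum → Bool) → Fin (l.sum + 1) → ℕ := fun u g =>
    if l.sum < g.val + K then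
      c + g.val + 2 * (univ.filter fun i : Fin l.sum => g.val ≤ i.val ∧ u i = true).card
    else c + g.val +
      (univ.filter fun i : Fin l.sum => P (J g.val) ≤ i.val ∧ i.val < g.val ∧ u i = true).card
  let lam : Fin (l.sum + 1) → ℕ → ℕ := fun g i =>
    if l.sum < g.val + K then 2 else if i < J g.val then 2 else 1
  have hlam_last : ∀ g : Fin (l.sum + 1), lam g t % 3 ≠ 0 := by
    intro g
    by_cases h1 : l.sum < g.val + K
    · simp [lam, h1]
    · have h2 : ¬ t < J g.val := not_lt.2 (hJle g.val)
      simp [lam, h1, h2]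
  -- the hypothetical counts `N(u; r)` for a residue assignment `r` (block `i` ↦ `r i`)
  let N : (Fin l.sum → Bool) → (ℕ → ℕ) → ℕ := fun u r =>
    ((univ : Finset (Fin (l.sum + 1))).filter fun g =>
      (y g u && decide ((A u g + ∑ i ∈ range (t + 1), lam g i * r i) % 3 ≠ 0)) = true).card
  -- (1) the characters: `c + g + e_g(u) ≡ A_g(u) + Σ_i lam_{g,i} R_i(u) (mod 3)`
  have hchar : ∀ (u : Fin l.sum → Bool) (g : Fin (l.sum + 1)),
      (c + g.val + walkExp u g.val) % 3 ≠ 0 ↔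
        (A u g + ∑ i ∈ range (t + 1), lam g i * R u i) % 3 ≠ 0 := by
    intro u g
    have hsumg := wtPrefix_add_wtSuffix u g.val
    by_cases hRt : l.sum < g.val + K
    · -- right end
      have hA : A u g = c + g.val +
          2 * (univ.filter fun i : Fin l.sum => g.val ≤ i.val ∧ u i = true).card := by
        simp only [A, if_pos hRt]
      have hl2 : ∑ i ∈ range (t + 1), lam g i * R u i = 2 * wt u := by
        rw [hwt u, Finset.mul_sum]
        refine Finset.sum_congr rfl fun i _ => ?_
        simp only [lam, if_pos hRt]
      rw [hA, hl2]
      unfold walkExp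
      constructor <;> intro h <;> omega
    · -- anchored at `P (J g)`
      have hA : A u g = c + g.val +
          (univ.filter fun i : Fin l.sum => P (J g.val) ≤ i.val ∧ i.val < g.val ∧ u i = true).card := by
        simp only [A, if_neg hRt]
      have hJt : J g.val ≤ t + 1 := by have := hJle g.val; omega
      have hl1 : ∑ i ∈ range (t + 1), lam g i * R u i = wt u + wtPrefix u (P (J g.val)) := by
        rw [hwt u, hpre u (J g.val) hJt, ← sum_anchorCoeff_mul (t + 1) (J g.val) hJt (R u)]
        refine Finset.sum_congr rfl fun i _ => ?_
        simp only [lam, if_neg hRt]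
      rw [hA, hl1]
      unfold walkExp
      rw [wtPrefix_eq_add_midCount u (hPJ g.val)]
      constructor <;> intro h <;> omega
  -- so the win bit is `N(u; R(u)) mod 2`
  have hwin : ∀ u, ringWinU c y u = decide (N u (R u) % 2 = 1) := by
    intro u
    have hset : (univ.filter fun g : Fin (l.sum + 1) =>
        y g u = true ∧ (c + g.val + walkExp u g.val) % 3 ≠ 0) =
        univ.filter fun g : Fin (l.sum + 1) =>
          (y g u && decide ((A u g + ∑ i ∈ range (t + 1), lam g i * R u i) % 3 ≠ 0)) = true := by
      refine Finset.filter_congr fun g _ => ?_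
      rw [hchar u g, Bool.and_eq_true, decide_eq_true_iff]
    have h : ringWinU c y u = decide ((univ.filter fun g : Fin (l.sum + 1) =>
        (y g u && decide ((A u g + ∑ i ∈ range (t + 1), lam g i * R u i) % 3 ≠ 0)) = true).card
          % 2 = 1) := by
      unfold ringWinU; rw [hset]
    exact h
  -- (2) the counts only see the residues mod 3
  have hNmod : ∀ (u : Fin l.sum → Bool) (r r' : ℕ → ℕ),
      (∀ i ∈ range (t + 1), r i % 3 = r' i % 3) → N u r = N u r' := by
    intro u r r' h
    refine congrArg Finset.card (Finset.filter_congr fun g _ => ?_)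
    have hm : (A u g + ∑ i ∈ range (t + 1), lam g i * r i) % 3 =
        (A u g + ∑ i ∈ range (t + 1), lam g i * r' i) % 3 := by
      rw [Nat.add_mod, sum_mul_mod_three_congr (range (t + 1)) (lam g) r r' h, ← Nat.add_mod]
    rw [hm]
  -- (3) each parity bit `[N(u; r) odd]` has degree `≤ D + K`
  have hPdeg : ∀ r : ℕ → ℕ, HasDeg (fun u => decide (N u r % 2 = 1)) (D + K) := by
    intro r
    have hfun : (fun u => decide (N u r % 2 = 1)) = fun u =>
        decide ((((univ : Finset (Fin (l.sum + 1))).filter fun g =>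
          (y g u && decide ((A u g + ∑ i ∈ range (t + 1), lam g i * r i) % 3 ≠ 0)) = true).card)
            % 2 = 1) := rfl
    rw [hfun]
    refine hasDeg_parity _ _ fun g _ => ?_
    have hgn : g.val ≤ l.sum := Nat.lt_succ_iff.1 g.isLt
    by_cases hRt : l.sum < g.val + K
    · -- right end: a function of the window `[g, n)`, fewer than `K` coordinates
      have h' : HasDeg (fun u : Fin l.sum → Bool =>
          decide ((A u g + ∑ i ∈ range (t + 1), lam g i * r i) % 3 ≠ 0)) K := by
        have heq : (fun u : Fin l.sum → Bool =>
            decide ((A u g + ∑ i ∈ range (t + 1), lam g i * r i) % 3 ≠ 0)) =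
            fun u => decide ((c + g.val +
              2 * (univ.filter fun i : Fin l.sum => g.val ≤ i.val ∧ u i = true).card +
              ∑ i ∈ range (t + 1), lam g i * r i) % 3 ≠ 0) := by
          funext u; simp only [A, if_pos hRt]
        rw [heq]
        exact hasDeg_of_le (hasDeg_rightChar c g.val _ hgn) (by omega)
      exact hasDeg_and (hdeg g) h'
    · by_cases hW : ∃ j, j < l.length ∧ P j ≤ g.val ∧ g.val < P j + K
      · -- a window position: a function of the window `[P (J g), g)`, fewer than `K` coordinates
        obtain ⟨j, hj, hPj, hgj⟩ := hW
        have hjJ : j ≤ J g.val := hJmax g.val j (by omega) hPj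
        have hPjJ : P j ≤ P (J g.val) := hPmono hjJ
        have h' : HasDeg (fun u : Fin l.sum → Bool =>
            decide ((A u g + ∑ i ∈ range (t + 1), lam g i * r i) % 3 ≠ 0)) K := by
          have heq : (fun u : Fin l.sum → Bool =>
              decide ((A u g + ∑ i ∈ range (t + 1), lam g i * r i) % 3 ≠ 0)) =
              fun u => decide ((c + g.val +
                (univ.filter fun i : Fin l.sum =>
                  P (J g.val) ≤ i.val ∧ i.val < g.val ∧ u i = true).card +
                ∑ i ∈ range (t + 1), lam g i * r i) % 3 ≠ 0) := by
            funext u; simp only [A, if_neg hRt]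
          rw [heq]
          exact hasDeg_of_le (hasDeg_midChar c (P (J g.val)) g.val _ hgn) (by omega)
        exact hasDeg_and (hdeg g) h'
      · -- elsewhere the selector vanishes
        have hout : ∀ j < l.length, g.val < (l.take j).sum ∨ (l.take j).sum + K ≤ g.val := by
          intro j hj
          rw [← hP j]
          by_contra hno
          push Not at hno
          exact hW ⟨j, hj, hno.1, hno.2⟩
        have hgK : g.val + K ≤ l.sum := by omega
        have hzero : (fun u : Fin l.sum → Bool =>
            y g u && decide ((A u g + ∑ i ∈ range (t + 1), lam g i * r i) % 3 ≠ 0)) =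
            fun _ => false := by
          funext u; rw [hsupp g hout hgK u, Bool.false_and]
        rw [hzero]
        exact hasDeg_false _
  -- (4) the cells `(0, …, 0, w)`: only the last block residue is `w`
  let δ : ℕ → ℕ → ℕ := fun w i => if i = t then w else 0
  have hδ : ∀ w i, δ w i = if i = t then w else 0 := fun _ _ => rfl
  have hNδ : ∀ (u : Fin l.sum → Bool) (w : ℕ),
      ((((univ : Finset (Fin (l.sum + 1))).filter fun g => y g u = true).filter
        fun g => (A u g + lam g t * w) % 3 ≠ 0).card) = N u (δ w) := by
    intro u w
    rw [Finset.filter_filter]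
    refine congrArg Finset.card (Finset.filter_congr fun g _ => ?_)
    rw [sum_mul_lastCell t (lam g) (δ w) w (hδ w), Bool.and_eq_true, decide_eq_true_iff]
  -- the last-block decoder `w₀(u)` (the first even cell among `w = 0, 1, 2`) has an even count
  have hdec_even : ∀ u : Fin l.sum → Bool,
      N u (δ (if N u (δ 0) % 2 = 0 then 0 else if N u (δ 1) % 2 = 0 then 1 else 2)) % 2 = 0 := by
    intro u
    have key := decoder_even (((univ : Finset (Fin (l.sum + 1))).filter fun g => y g u = true))
      (A u) (fun g => lam g t) (fun g _ => hlam_last g)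
    simp only [hNδ u] at key
    exact key
  -- (5) the two decoder bits, of degree `≤ (D + K) + (D + K)`
  let Pb : (ℕ → ℕ) → (Fin l.sum → Bool) → Bool := fun r u => decide (N u r % 2 = 1)
  let a : (Fin l.sum → Bool) → Bool := fun u => Pb (δ 0) u && !Pb (δ 1) u
  let b : (Fin l.sum → Bool) → Bool := fun u => Pb (δ 0) u && Pb (δ 1) u
  have ha : HasDeg a (D + K + (D + K)) := hasDeg_and_not (hPdeg (δ 0)) (hPdeg (δ 1))
  have hb : HasDeg b (D + K + (D + K)) := hasDeg_and (hPdeg (δ 0)) (hPdeg (δ 1))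
  let dec : ZMod 2 → ZMod 2 → ℕ := fun α β => if α = 1 then 1 else if β = 1 then 2 else 0
  -- decoders for `multiElimHard`: `(a, b, dec)` on the last block, `(0, 0, 0)` on the others
  let aP : ℕ → CubeFn (ZMod 2) l.sum := fun i =>
    if i = t then (fun u => if a u then 1 else 0) else 0
  let bP : ℕ → CubeFn (ZMod 2) l.sum := fun i =>
    if i = t then (fun u => if b u then 1 else 0) else 0
  let decP : ℕ → ZMod 2 → ZMod 2 → ℕ := fun i => if i = t then dec else fun _ _ => 0
  have haP : ∀ i, aP i ∈ lowDeg (ZMod 2) l.sum (D + K + (D + K)) := by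
    intro i
    by_cases hi : i = t
    · simp only [aP, if_pos hi]; exact ha
    · simp only [aP, if_neg hi]; exact Submodule.zero_mem _
  have hbP : ∀ i, bP i ∈ lowDeg (ZMod 2) l.sum (D + K + (D + K)) := by
    intro i
    by_cases hi : i = t
    · simp only [bP, if_pos hi]; exact hb
    · simp only [bP, if_neg hi]; exact Submodule.zero_mem _
  -- (6) multi-block elimination: all `t + 1` residues are named on `≥ η·2ⁿ` inputs
  have hJoint := hE l hl hMl (D + K + (D + K)) hdl aP bP haP hbP decP
  -- (7) where all residues are named, the strategy loses
  have hlose : (univ.filter fun u : Fin l.sum → Bool => allNamed l aP bP decP u = true) ⊆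
      univ.filter fun u : Fin l.sum → Bool => ¬ ringWinU c y u = true := by
    intro u hu
    rw [mem_filter] at hu
    rw [mem_filter]
    refine ⟨mem_univ _, ?_⟩
    have hall := (allNamed_iff l aP bP decP u).1 hu.2
    -- the decoded last residue
    have hdec : dec (if a u then 1 else 0) (if b u then 1 else 0) =
        (if N u (δ 0) % 2 = 0 then 0 else if N u (δ 1) % 2 = 0 then 1 else 2) := by
      have hdec_bool : ∀ p0 p1 : Bool,
          dec (if (p0 && !p1) = true then 1 else 0) (if (p0 && p1) = true then 1 else 0) =
            (if p0 = false then 0 else if p1 = false then 1 else 2) := by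
        intro p0 p1; cases p0 <;> cases p1 <;> simp [dec]
      have h := hdec_bool (Pb (δ 0) u) (Pb (δ 1) u)
      have e0 : (Pb (δ 0) u = false) ↔ N u (δ 0) % 2 = 0 := by
        simp only [Pb, decide_eq_false_iff_not]; omega
      have e1 : (Pb (δ 1) u = false) ↔ N u (δ 1) % 2 = 0 := by
        simp only [Pb, decide_eq_false_iff_not]; omega
      simp only [e0, e1] at h
      exact h
    have hlast : (if N u (δ 0) % 2 = 0 then 0 else if N u (δ 1) % 2 = 0 then 1 else 2) % 3 =
        R u t % 3 := by
      have h := hall t (by omega)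
      simp only [aP, bP, decP, if_true] at h
      rw [hdec, ← hR u t] at h
      exact h
    have hothers : ∀ i < t, R u i % 3 = 0 := by
      intro i hi
      have h := hall i (by omega)
      have hne : i ≠ t := by omega
      simp only [decP, if_neg hne, Nat.zero_mod] at h
      rw [← hR u i] at h
      omega
    -- the true residues agree mod 3 with the decoded cell `(0, …, 0, w₀(u))`
    have hagree : ∀ i ∈ range (t + 1), R u i % 3 =
        δ (if N u (δ 0) % 2 = 0 then 0 else if N u (δ 1) % 2 = 0 then 1 else 2) i % 3 := by
      intro i hi
      rw [mem_range] at hi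
      by_cases hit : i = t
      · rw [hit, hδ, if_pos rfl]
        exact hlast.symm
      · rw [hδ, if_neg hit, hothers i (by omega)]
    have hNeq := hNmod u _ _ hagree
    have heven := hdec_even u
    rw [hwin u, hNeq]
    simp only [decide_eq_true_eq]
    omega
  -- (8) count
  have hcount : ((univ.filter fun u : Fin l.sum → Bool => ringWinU c y u = true).card : ℝ) +
      ((univ.filter fun u : Fin l.sum → Bool => ¬ ringWinU c y u = true).card : ℝ) =
        (2 : ℝ) ^ l.sum := by
    have h := Finset.card_filter_add_card_filter_not (s := (univ : Finset (Fin l.sum → Bool)))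
      (fun u => ringWinU c y u = true)
    rw [Finset.card_univ, Fintype.card_fun, Fintype.card_bool, Fintype.card_fin] at h
    exact_mod_cast h
  have hge : η * (2 : ℝ) ^ l.sum ≤
      ((univ.filter fun u : Fin l.sum → Bool => ¬ ringWinU c y u = true).card : ℝ) :=
    hJoint.trans (by exact_mod_cast Finset.card_le_card hlose)
  linarith

end Summit.QuantumAdvantage.AdviceFreeQNC0
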